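import Summits.Ventures.LatticeQCDFlow.Scoring.ChainTauIntVarianceEstimator
import Summits.Ventures.LatticeQCDFlow.Scoring.ChainScorerStrongLaw
import Summits.Ventures.LatticeQCDFlow.Scoring.MeanSubtractionCLT
import Summits.Ventures.LatticeQCDFlow.Exactness.NCMCGeneralSpaceLagProductMoments

/-!
# THE FULLY EMPIRICAL VARIANCE ESTIMATE FOR `τ̂_W` ON MARKOV-CHAIN DATA: centring the lag products at the
# SAMPLE MEAN and the gradient at scorer A's own `Γ̂` changes nothing in the limit —
# `σ̂²_A,N → σ²_ℓ = ℓᵀ Σ ℓ` in probability from EVERY initial law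

HONEST FRAMING: exact (Metropolis-corrected) sampling algorithms for lattice gauge theory;
figures of merit are autocorrelation/cost numbers at stated couplings and volumes; no
continuum-physics claim.

Venture `LatticeQCDFlow` (cell pub-lqcd), sub-topic `Scoring`; FANOUT row 16 (`su2-base`), GEN-10.
NEW WORK of the cell, not a published result; no definition is introduced; nothing is cited as a fact.
GEN-10's `Scoring/ChainTauIntVarianceEstimator` proved `σ̂²_N → σ²_ℓ` for the statistic built from the
lag products `f̄(X_i) f̄(X_{i+s})` of the TRUE-MEAN-centred observable `f̄ = f − ∫ f dπ` and the gradient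
at the known-mean `Γ̂_N`, and listed 'sample-mean centring INSIDE the lag products' as NOT CLAIMED.  THIS
FILE removes that restriction: with `m_N = (1/N) Σ_{i<N} f(X_i)` the sample mean,
`p̃^s_i = (f(X_i) − m_N)(f(X_{i+s}) − m_N)` the EMPIRICALLY centred lag products and
`ℓ̂^A_N = tauHatGrad W (gammaHat (f ∘ X) N t)_t` the gradient at SCORER A's OWN autocovariances, the
statistic `σ̂²_{A,N} = Σ_s Σ_t ℓ̂^A_s ℓ̂^A_t gammaCross p̃^s p̃^t N K_N` — a function of the data
`f(X_0), …, f(X_{N+W})` alone — converges in `P_{μ₀}`-probability to `σ²_ℓ`, from EVERY initial law,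
for truncations `K_N → ∞` with `K_N³/N → 0`.  Mechanism: a DETERMINISTIC perturbation bound for scorer
A's windowed statistic (`|gammaStat ũ − gammaStat u| ≤ (2K+1) · 4η (M + M')` when `|ũ − u| ≤ η`
termwise, `|u| ≤ M`, `|ũ| ≤ M'`), the termwise bound `|p̃^s_i − p^s_i| ≤ 4C |δ_N| + δ_N²`
(`δ_N = m_N − ∫ f dπ`), and `K_N δ_N → 0` in probability (row 13's any-start second-moment bound
`E_{μ₀}[(Σ_{i<N} f̄(X_i))²] ≤ K N`, Markov), so the perturbation is `O_P(K_N/√N) → 0`; the gradient by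
GEN-9's almost-sure consistency of scorer A's `Γ̂` along the chain (`ChainScorerStrongLaw`).

## Content (`κ` Markov, `π` invariant, `(nHit κ m)(z, ·) ≥ ε ν` for all `z`, `ε ≠ 0`, `0 < m`;
## `|f| ≤ C` measurable, `f̄ = f − ∫ f dπ`, `C(t) = autocov κ π f̄ t`, `C(0) ≠ 0`, `Σ = chainLagACov κ π f̄ W`;
## `K_N → ∞`, `K_N³/N → 0`; `μ₀` ANY initial law)

* (the real-series perturbation bounds are GEN-10's `Scoring/GammaStatSeries`);
* `tendstoInMeasure_of_abs_sub_le` — `U_N → u`, `|V_N − U_N| ≤ B_N`, `B_N → 0` in measure ⇒ `V_N → u`;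
* `abs_empLagProd_sub_le` — `|p̃^s_i − p^s_i| ≤ 4C |δ_N| + δ_N²`;
  `tendstoInMeasure_chain_scaled_meanDev_of_nHit` — `c_N δ_N → 0` in measure whenever `c_N²/N → 0`;
* **`chain_empGammaCross_tendstoInMeasure_of_nHit`** — `gammaCross p̃^s p̃^t N K_N → Σ(s,t)` in measure;
* `chain_scorer_tauHatGrad_tendstoInMeasure_of_nHit` — `ℓ̂^A_{N,i} → ℓ_i` in measure;
* **`chain_empTauIntVarHat_tendstoInMeasure_of_nHit`** — `σ̂²_{A,N} → Σ_s Σ_t ℓ_s ℓ_t Σ(s,t) = σ²_ℓ`.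

NOT CLAIMED: the automatic window; `σ²_ℓ > 0`; almost-sure convergence; rates; any number about row
16's chains.
-/

noncomputable section

open MeasureTheory ProbabilityTheory Filter Finset Preorder WithLp
open scoped ENNReal NNReal Topology RealInnerProductSpace
open Summit.Ventures.LatticeQCDFlow.Exactness Summit.Ventures.LatticeQCDFlow.Exactness.GeneralNCMC

namespace Summit.Ventures.LatticeQCDFlow.Scoring

/-! ## A squeeze for convergence in measure -/

section InMeasure

variable {Ω : Type*} [MeasurableSpace Ω] {P : Measure Ω}

/-- **Squeeze**: `U_N → u` in measure, `|V_N − U_N| ≤ B_N` pointwise and `B_N → 0` in measure ⇒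
`V_N → u` in measure. -/
theorem tendstoInMeasure_of_abs_sub_le {U V B : ℕ → Ω → ℝ} {u : ℝ}
    (hU : TendstoInMeasure P U atTop fun _ => u) (hB : TendstoInMeasure P B atTop fun _ => 0)
    (hle : ∀ N ω, |V N ω - U N ω| ≤ B N ω) :
    TendstoInMeasure P V atTop fun _ => u := by
  rw [tendstoInMeasure_iff_norm] at hU hB ⊢
  intro δ hδ
  have hδ2 : 0 < δ / 2 := by linarith
  have hsum := (hU (δ / 2) hδ2).add (hB (δ / 2) hδ2)
  rw [add_zero] at hsum
  refine tendsto_of_tendsto_of_tendsto_of_le_of_le' tendsto_const_nhds hsum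
    (Eventually.of_forall fun N => zero_le) (Eventually.of_forall fun N => ?_)
  refine (measure_mono fun ω hω => ?_).trans (measure_union_le _ _)
  simp only [Set.mem_setOf_eq, Set.mem_union, Real.norm_eq_abs, sub_zero] at hω ⊢
  by_cases h1 : δ / 2 ≤ |U N ω - u|
  · exact Or.inl h1
  · refine Or.inr (not_lt.1 fun h2 => ?_)
    have h1' : |U N ω - u| < δ / 2 := not_le.1 h1
    have h3 : |V N ω - U N ω| < δ / 2 := (hle N ω).trans_lt ((le_abs_self _).trans_lt h2)
    have : |V N ω - u| < δ := by
      calc |V N ω - u| = |(V N ω - U N ω) + (U N ω - u)| := by ring_nf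
        _ ≤ |V N ω - U N ω| + |U N ω - u| := abs_add_le _ _
        _ < δ / 2 + δ / 2 := add_lt_add h3 h1'
        _ = δ := by ring
    exact absurd hω (not_le.2 this)

end InMeasure

/-! ## Along the chain -/

section Chain

variable {S : Type*} [MeasurableSpace S]
variable (κ : Kernel S S) [IsMarkovKernel κ] (W : ℕ) {π : Measure S} [IsProbabilityMeasure π]
  {ν : Measure S} [IsProbabilityMeasure ν] {ε : ℝ≥0∞} {m : ℕ}

omit [MeasurableSpace S] in
/-- **The empirically centred lag products are uniformly close to the true-mean-centred ones**: with
`m_N = sampleMean (f ∘ x) N`, `δ_N = m_N − c` and `|f| ≤ C`, for all `i, s`: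
`|(f(x_i) − m_N)(f(x_{i+s}) − m_N) − (f(x_i) − c)(f(x_{i+s}) − c)| ≤ 4C |δ_N| + δ_N²` (`|c| ≤ C`). -/
theorem abs_empLagProd_sub_le {f : S → ℝ} {C : ℝ} (hC : ∀ z, |f z| ≤ C) {c : ℝ} (hc : |c| ≤ C)
    (x : ℕ → S) (N i s : ℕ) :
    |(f (x i) - sampleMean (fun j => f (x j)) N) * (f (x (i + s)) - sampleMean (fun j => f (x j)) N)
        - (f (x i) - c) * (f (x (i + s)) - c)|
      ≤ 4 * C * |sampleMean (fun j => f (x j)) N - c| + (sampleMean (fun j => f (x j)) N - c) ^ 2 := by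
  set mN := sampleMean (fun j => f (x j)) N with hmN
  set δ := mN - c with hδ
  have hg : ∀ z, |f z - c| ≤ 2 * C := fun z =>
    (abs_sub _ _).trans ((add_le_add (hC z) hc).trans (by ring_nf; rfl))
  have e : (f (x i) - mN) * (f (x (i + s)) - mN) - (f (x i) - c) * (f (x (i + s)) - c)
      = -(δ * ((f (x i) - c) + (f (x (i + s)) - c))) + δ ^ 2 := by
    simp only [hδ]; ring
  rw [e]
  calc |-(δ * ((f (x i) - c) + (f (x (i + s)) - c))) + δ ^ 2|
      ≤ |-(δ * ((f (x i) - c) + (f (x (i + s)) - c)))| + |δ ^ 2| := abs_add_le _ _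
    _ = |δ| * |(f (x i) - c) + (f (x (i + s)) - c)| + δ ^ 2 := by rw [abs_neg, abs_mul, abs_pow, sq_abs]
    _ ≤ |δ| * (2 * C + 2 * C) + δ ^ 2 := by
        refine add_le_add (mul_le_mul_of_nonneg_left ((abs_add_le _ _).trans
          (add_le_add (hg _) (hg _))) (abs_nonneg _)) le_rfl
    _ = 4 * C * |δ| + δ ^ 2 := by ring

/-- **Scaled deviations of the sample mean vanish in probability**: for every real sequence `c_N` with
`c_N²/N → 0`, `c_N · (sampleMean (f ∘ x) N − ∫ f dπ) → 0` in `P_{μ₀}`-measure, from every initial law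
(row 13's second-moment bound `E_{μ₀}[(Σ_{i<N} f̄(X_i))²] ≤ K N`, Jensen, Markov). -/
theorem tendstoInMeasure_chain_scaled_meanDev_of_nHit (hπ : Kernel.Invariant κ π) (hε : ε ≠ 0)
    (hmin : ∀ z, ε • ν ≤ nHit κ m z) (hm : 0 < m) {f : S → ℝ} (hf : Measurable f) {C : ℝ}
    (hC : ∀ z, |f z| ≤ C) {c : ℕ → ℝ} (hc : Tendsto (fun N => c N ^ 2 / N) atTop (𝓝 0))
    (μ₀ : Measure S) [IsProbabilityMeasure μ₀] :
    TendstoInMeasure (Kernel.trajMeasure (X := fun _ : ℕ => S) μ₀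
        (fun n : ℕ => κ.comap (fun hh : (i : ↥(Finset.Iic n)) → S => hh ⟨n, Finset.mem_Iic.2 le_rfl⟩)
          (measurable_pi_apply _)))
      (fun (N : ℕ) (x : ℕ → S) => c N * (sampleMean (fun j => f (x j)) N - ∫ z', f z' ∂π))
      atTop (fun _ => 0) := by
  set P := Kernel.trajMeasure (X := fun _ : ℕ => S) μ₀
    (fun n : ℕ => κ.comap (fun hh : (i : ↥(Finset.Iic n)) → S => hh ⟨n, Finset.mem_Iic.2 le_rfl⟩)
      (measurable_pi_apply _)) with hP
  haveI := isMarkovKernel_nHit κ m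
  haveI : Nonempty S := nonempty_of_isProbabilityMeasure π
  have hε0 : 0 < ε := pos_iff_ne_zero.2 hε
  have hε1 : ε ≤ 1 := eps_le_one_of_minorised hmin
  have hminS : ∀ x {B : Set S}, MeasurableSet B → ε * ν B ≤ nHit κ m x B :=
    fun x _ hB => minorised_setwise hmin x hB
  obtain ⟨hfbm, hfbC, -⟩ := centred_observable_bounds π hf hC
  have hmeanC : |∫ z', f z' ∂π| ≤ C := by
    rw [← Real.norm_eq_abs]
    calc ‖∫ z', f z' ∂π‖ ≤ C * π.real Set.univ :=
          norm_integral_le_of_norm_le_const (Eventually.of_forall fun z => by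
            rw [Real.norm_eq_abs]; exact hC z)
      _ = C := by rw [probReal_univ, mul_one]
  set K : ℝ := (2 * C) ^ 2 * (2 + 4 * m / ε.toReal) with hK
  -- the statistic `c_N δ_N`, its measurability and bound
  set R : ℕ → (ℕ → S) → ℝ :=
    fun N x => c N * (sampleMean (fun j => f (x j)) N - ∫ z', f z' ∂π) with hR
  have hdev : ∀ N (x : ℕ → S), 0 < N → sampleMean (fun j => f (x j)) N - ∫ z', f z' ∂π
      = (∑ i ∈ range N, (f (x i) - ∫ z', f z' ∂π)) / N := fun N x hN => by
    have hNR : (N : ℝ) ≠ 0 := (Nat.cast_pos.2 hN).ne'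
    unfold sampleMean
    rw [sum_sub_distrib, sum_const, card_range, nsmul_eq_mul]
    field_simp
  have hSm : ∀ N, Measurable fun x : ℕ → S => sampleMean (fun j => f (x j)) N - ∫ z', f z' ∂π :=
    fun N => (measurable_sampleMean_series (fun j => hf.comp (measurable_pi_apply j)) N).sub
      measurable_const
  have hRm : ∀ N, Measurable (R N) := fun N => measurable_const.mul (hSm N)
  have hSb : ∀ N (x : ℕ → S), |sampleMean (fun j => f (x j)) N - ∫ z', f z' ∂π| ≤ 2 * C := fun N x =>
    calc |sampleMean (fun j => f (x j)) N - ∫ z', f z' ∂π|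
        ≤ |sampleMean (fun j => f (x j)) N| + |∫ z', f z' ∂π| := abs_sub _ _
      _ ≤ C + C := add_le_add (abs_sampleMean_le (fun j => hC (x j)) N) hmeanC
      _ = 2 * C := by ring
  have hRb : ∀ N x, |R N x| ≤ |c N| * (2 * C) := fun N x => by
    simp only [hR]; rw [abs_mul]; exact mul_le_mul_of_nonneg_left (hSb N x) (abs_nonneg _)
  -- second moment for `N > 0`: `E R_N² ≤ K c_N² / N`
  have hsq : ∀ N, 0 < N → ∫ x, R N x ^ 2 ∂P ≤ K * (c N ^ 2 / N) := fun N hN => by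
    have hNR : (0 : ℝ) < N := Nat.cast_pos.2 hN
    have hmom := chain_sq_sum_centred_le_of_nHit (μ₀ := μ₀) hminS hε0 hε1 hm hπ hf hC 0 N
    rw [← hP] at hmom
    simp only [Nat.zero_add] at hmom
    have hRsq : ∀ x, R N x ^ 2
        = (c N ^ 2 * (N : ℝ)⁻¹ ^ 2) * (∑ i ∈ range N, (f (x i) - ∫ z', f z' ∂π)) ^ 2 := fun x => by
      simp only [hR, hdev N x hN, div_eq_mul_inv]; ring
    simp_rw [hRsq]
    rw [integral_const_mul]
    calc c N ^ 2 * (N : ℝ)⁻¹ ^ 2 * ∫ x, (∑ i ∈ range N, (f (x i) - ∫ z', f z' ∂π)) ^ 2 ∂P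
        ≤ c N ^ 2 * (N : ℝ)⁻¹ ^ 2 * (K * N) := mul_le_mul_of_nonneg_left hmom (by positivity)
      _ = K * (c N ^ 2 / N) := by field_simp
  -- first moment by Jensen, then Markov (eventually in `N`)
  have hb0 : Tendsto (fun N : ℕ => Real.sqrt (K * (c N ^ 2 / N))) atTop (𝓝 0) := by
    have h := (hc.const_mul K).sqrt
    rwa [mul_zero, Real.sqrt_zero] at h
  have hev : ∀ᶠ N : ℕ in atTop, Integrable (fun x => |R N x|) P
      ∧ ∫ x, |R N x| ∂P ≤ Real.sqrt (K * (c N ^ 2 / N)) := by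
    filter_upwards [Filter.eventually_gt_atTop 0] with N hN
    refine ⟨(integrable_of_bounded _ (hRm N) (hRb N)).abs, ?_⟩
    have hJ := sq_integral_le_integral_sq P (hRm N).abs (C := |c N| * (2 * C)) (fun x => by
      rw [abs_abs]; exact hRb N x)
    simp only [sq_abs] at hJ
    calc ∫ x, |R N x| ∂P = Real.sqrt ((∫ x, |R N x| ∂P) ^ 2) :=
          (Real.sqrt_sq (integral_nonneg fun x => abs_nonneg _)).symm
      _ ≤ Real.sqrt (K * (c N ^ 2 / N)) := Real.sqrt_le_sqrt (hJ.trans (hsq N hN))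
  have h := CardConsistency.tendstoInMeasure_zero_of_integral_le (P := P) (f := fun N x => |R N x|)
    (fun N x => abs_nonneg _) hb0 hev
  rw [tendstoInMeasure_iff_norm] at h ⊢
  simpa only [sub_zero, Real.norm_eq_abs, abs_abs] using h

/-- `K_N²/N → 0` whenever `K_N → ∞` and `K_N³/N → 0`. -/
theorem tendsto_sq_div_of_cube_div {K : ℕ → ℕ} (hK : Tendsto K atTop atTop)
    (hK3 : Tendsto (fun N => (K N : ℝ) ^ 3 / N) atTop (𝓝 0)) :
    Tendsto (fun N => (K N : ℝ) ^ 2 / N) atTop (𝓝 0) := by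
  refine squeeze_zero' (Eventually.of_forall fun N => by positivity) ?_ hK3
  filter_upwards [hK.eventually_ge_atTop 1] with N hN
  have hK1 : (1 : ℝ) ≤ K N := by exact_mod_cast hN
  exact div_le_div_of_nonneg_right (pow_le_pow_right₀ hK1 (by norm_num)) (Nat.cast_nonneg N)

/-- **THE POLARISED MATRIX ESTIMATOR WITH EMPIRICALLY CENTRED LAG PRODUCTS IS CONSISTENT**: with
`m_N = sampleMean (f ∘ X) N`, `p̃^s_i = (f(X_i) − m_N)(f(X_{i+s}) − m_N)` and truncations `K_N → ∞`,
`K_N³/N → 0`: `gammaCross p̃^s p̃^t N K_N → Σ(s,t)` in `P_{μ₀}`-measure, from EVERY initial law. -/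
theorem chain_empGammaCross_tendstoInMeasure_of_nHit (hπ : Kernel.Invariant κ π) (hε : ε ≠ 0)
    (hmin : ∀ z, ε • ν ≤ nHit κ m z) (hm : 0 < m)
    {f : S → ℝ} (hf : Measurable f) {C : ℝ} (hC : ∀ z, |f z| ≤ C)
    {K : ℕ → ℕ} (hK : Tendsto K atTop atTop) (hK3 : Tendsto (fun N => (K N : ℝ) ^ 3 / N) atTop (𝓝 0))
    (μ₀ : Measure S) [IsProbabilityMeasure μ₀] (s t : Fin (W + 1)) :
    TendstoInMeasure (Kernel.trajMeasure (X := fun _ : ℕ => S) μ₀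
        (fun n : ℕ => κ.comap (fun hh : (i : ↥(Finset.Iic n)) → S => hh ⟨n, Finset.mem_Iic.2 le_rfl⟩)
          (measurable_pi_apply _)))
      (fun (N : ℕ) (x : ℕ → S) =>
        gammaCross
          (fun i => (f (x i) - sampleMean (fun j => f (x j)) N)
            * (f (x (i + s)) - sampleMean (fun j => f (x j)) N))
          (fun i => (f (x i) - sampleMean (fun j => f (x j)) N)
            * (f (x (i + t)) - sampleMean (fun j => f (x j)) N)) N (K N))
      atTop (fun _ => chainLagACov κ π (fun z => f z - ∫ z', f z' ∂π) W s t) := by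
  haveI : Nonempty S := nonempty_of_isProbabilityMeasure π
  have hC0 : 0 ≤ C := (abs_nonneg _).trans (hC (Classical.choice ‹Nonempty S›))
  obtain ⟨-, hfbC, -⟩ := centred_observable_bounds π hf hC
  have hmeanC : |∫ z', f z' ∂π| ≤ C := by
    rw [← Real.norm_eq_abs]
    calc ‖∫ z', f z' ∂π‖ ≤ C * π.real Set.univ :=
          norm_integral_le_of_norm_le_const (Eventually.of_forall fun z => by
            rw [Real.norm_eq_abs]; exact hC z)
      _ = C := by rw [probReal_univ, mul_one]
  -- the true-mean statistic converges (GEN-10's `ChainTauIntVarianceEstimator`)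
  have hU := chain_gammaCross_tendstoInMeasure_of_nHit κ W hπ hε hmin hm hf hC hK hK3 μ₀ s t
  -- `δ_N → 0` and `K_N δ_N → 0` in measure
  have hδ := tendstoInMeasure_chain_scaled_meanDev_of_nHit κ hπ hε hmin hm hf hC (c := fun _ => (1 : ℝ))
    (by simpa using tendsto_const_div_atTop_nhds_zero_nat (1 : ℝ)) μ₀
  have hD := tendstoInMeasure_chain_scaled_meanDev_of_nHit κ hπ hε hmin hm hf hC (c := fun N => (K N : ℝ))
    (tendsto_sq_div_of_cube_div hK hK3) μ₀
  simp only [one_mul] at hδ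
  -- the perturbation bound as a continuous function of `(K_N δ_N, δ_N)`, vanishing at the origin
  set Φ : ℝ × ℝ → ℝ := fun q =>
    12 * (2 * C * (2 * C) + 2 * C * (2 * C)) * (8 * C * |q.1| + 4 * C * |q.2| + 2 * q.1 * q.2 + q.2 ^ 2)
    with hΦ
  have hΦc : Continuous Φ := by simp only [hΦ]; fun_prop
  have hB := CardConsistency.tendstoInMeasure_comp_continuousAt_normed
    (CardConsistency.tendstoInMeasure_prodMk hD hδ) (φ := Φ) hΦc.continuousAt
  have hΦ0 : Φ (0, 0) = 0 := by simp [hΦ]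
  rw [hΦ0] at hB
  refine tendstoInMeasure_of_abs_sub_le hU hB fun N x => ?_
  -- the deterministic bound on the path `x` at sample size `N`
  set mN := sampleMean (fun j => f (x j)) N with hmN
  set δ := mN - ∫ z', f z' ∂π with hδdef
  have hη : ∀ (r : Fin (W + 1)) (i : ℕ), |(f (x i) - mN) * (f (x (i + r)) - mN)
      - (f (x i) - ∫ z', f z' ∂π) * (f (x (i + r)) - ∫ z', f z' ∂π)| ≤ 4 * C * |δ| + δ ^ 2 :=
    fun r i => abs_empLagProd_sub_le hC hmeanC x N i r
  have hmNC : |mN| ≤ C := abs_sampleMean_le (fun j => hC (x j)) N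
  have hM : ∀ (r : Fin (W + 1)) (i : ℕ), |(f (x i) - mN) * (f (x (i + r)) - mN)| ≤ 2 * C * (2 * C) :=
    fun r i => by
      rw [abs_mul]
      have h1 : ∀ j, |f (x j) - mN| ≤ 2 * C := fun j =>
        (abs_sub _ _).trans ((add_le_add (hC _) hmNC).trans (by ring_nf; rfl))
      exact mul_le_mul (h1 _) (h1 _) (abs_nonneg _) (by positivity)
  have hM' : ∀ (r : Fin (W + 1)) (i : ℕ),
      |(f (x i) - ∫ z', f z' ∂π) * (f (x (i + r)) - ∫ z', f z' ∂π)| ≤ 2 * C * (2 * C) := fun r i => by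
    rw [abs_mul]; exact mul_le_mul (hfbC _) (hfbC _) (abs_nonneg _) (by positivity)
  have hbound := abs_gammaCross_sub_le (hη s) (hη t) (hM s) (hM t) (hM' s) (hM' t) N (K N)
  refine hbound.trans (le_of_eq ?_)
  have hKδ : |(K N : ℝ) * δ| = K N * |δ| := by rw [abs_mul, Nat.abs_cast]
  simp only [hΦ, hKδ]
  ring

/-- **Scorer A's own gradient estimate converges in probability**: with `Γ̂^A_N(t) = gammaHat (f ∘ X) N t`
and `C(0) ≠ 0`, every coordinate of `ℓ̂^A_N = tauHatGrad W (Γ̂^A_N(t))_t` converges in `P_{μ₀}`-measure to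
the coordinate of `ℓ` (from GEN-9's almost-sure consistency of scorer A's `Γ̂`, `ChainScorerStrongLaw`). -/
theorem chain_scorer_tauHatGrad_tendstoInMeasure_of_nHit (hπ : Kernel.Invariant κ π) (hε : ε ≠ 0)
    (hmin : ∀ z, ε • ν ≤ nHit κ m z) {f : S → ℝ} (hf : Measurable f) {C : ℝ} (hC : ∀ z, |f z| ≤ C)
    (hσ : autocov κ π (fun z => f z - ∫ z', f z' ∂π) 0 ≠ 0)
    (μ₀ : Measure S) [IsProbabilityMeasure μ₀] (i : Fin (W + 1)) :
    TendstoInMeasure (Kernel.trajMeasure (X := fun _ : ℕ => S) μ₀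
        (fun n : ℕ => κ.comap (fun hh : (i : ↥(Finset.Iic n)) → S => hh ⟨n, Finset.mem_Iic.2 le_rfl⟩)
          (measurable_pi_apply _)))
      (fun (N : ℕ) (x : ℕ → S) => tauHatGrad W (toLp 2 fun u : Fin (W + 1) =>
        gammaHat (fun j => f (x j)) N u) i)
      atTop (fun _ => tauHatGrad W (toLp 2 fun u : Fin (W + 1) =>
        autocov κ π (fun z => f z - ∫ z', f z' ∂π) u) i) := by
  have hGam := ae_all_iff.2 fun u : ℕ => ae_tendsto_chain_gammaHat_of_nHit κ hπ hε hmin hf hC μ₀ u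
  have hGm : ∀ N u, Measurable fun x : ℕ → S => gammaHat (fun j => f (x j)) N u := fun N u =>
    measurable_gammaHat_series (u := fun j (x : ℕ → S) => f (x j)) (fun j => hf.comp (measurable_pi_apply j)) N u
  have hLm : ∀ N, Measurable fun x : ℕ → S => tauHatGrad W (toLp 2 fun u : Fin (W + 1) =>
      gammaHat (fun j => f (x j)) N u) i := fun N => by
    simp only [tauHatGrad_coord]
    by_cases hi : i = 0
    · simp only [hi, if_true]
      exact (Finset.measurable_sum _ fun t _ => hGm N _).neg.div ((hGm N 0).pow_const 2)
    · simp only [hi, if_false]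
      exact measurable_const.div (hGm N 0)
  refine tendstoInMeasure_of_tendsto_ae (fun N => (hLm N).aestronglyMeasurable) ?_
  filter_upwards [hGam] with x hGx
  simp only [tauHatGrad_coord]
  by_cases hi : i = 0
  · simp only [hi, if_true]
    exact ((tendsto_finsetSum _ fun t _ => hGx _).neg).div ((hGx 0).pow 2) (pow_ne_zero 2 hσ)
  · simp only [hi, if_false]
    exact tendsto_const_nhds.div (hGx 0) hσ

/-- **THE FULLY EMPIRICAL PLUG-IN VARIANCE OF `τ̂_W` IS CONSISTENT ON CHAIN DATA, FROM EVERY INITIAL LAW.**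
With `m_N = sampleMean (f ∘ X) N`, `p̃^s_i = (f(X_i) − m_N)(f(X_{i+s}) − m_N)`,
`ℓ̂^A_N = tauHatGrad W (gammaHat (f ∘ X) N t)_t`, `C(0) ≠ 0` and truncations `K_N → ∞`, `K_N³/N → 0`:
`σ̂²_{A,N} = Σ_s Σ_t ℓ̂^A_{N,s} ℓ̂^A_{N,t} gammaCross p̃^s p̃^t N K_N → σ²_ℓ = Σ_s Σ_t ℓ_s ℓ_t Σ(s,t)` in
`P_{μ₀}`-measure — a statistic of the observed values `f(X_0), …, f(X_{N+W})` alone. -/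
theorem chain_empTauIntVarHat_tendstoInMeasure_of_nHit (hπ : Kernel.Invariant κ π) (hε : ε ≠ 0)
    (hmin : ∀ z, ε • ν ≤ nHit κ m z) (hm : 0 < m)
    {f : S → ℝ} (hf : Measurable f) {C : ℝ} (hC : ∀ z, |f z| ≤ C)
    (hσ : autocov κ π (fun z => f z - ∫ z', f z' ∂π) 0 ≠ 0)
    {K : ℕ → ℕ} (hK : Tendsto K atTop atTop) (hK3 : Tendsto (fun N => (K N : ℝ) ^ 3 / N) atTop (𝓝 0))
    (μ₀ : Measure S) [IsProbabilityMeasure μ₀] :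
    TendstoInMeasure (Kernel.trajMeasure (X := fun _ : ℕ => S) μ₀
        (fun n : ℕ => κ.comap (fun hh : (i : ↥(Finset.Iic n)) → S => hh ⟨n, Finset.mem_Iic.2 le_rfl⟩)
          (measurable_pi_apply _)))
      (fun (N : ℕ) (x : ℕ → S) => ∑ s : Fin (W + 1), ∑ t : Fin (W + 1),
        tauHatGrad W (toLp 2 fun u : Fin (W + 1) => gammaHat (fun j => f (x j)) N u) s
          * tauHatGrad W (toLp 2 fun u : Fin (W + 1) => gammaHat (fun j => f (x j)) N u) t
          * gammaCross
              (fun i => (f (x i) - sampleMean (fun j => f (x j)) N)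
                * (f (x (i + s)) - sampleMean (fun j => f (x j)) N))
              (fun i => (f (x i) - sampleMean (fun j => f (x j)) N)
                * (f (x (i + t)) - sampleMean (fun j => f (x j)) N)) N (K N))
      atTop (fun _ => ∑ s : Fin (W + 1), ∑ t : Fin (W + 1),
        tauHatGrad W (toLp 2 fun u : Fin (W + 1) => autocov κ π (fun z => f z - ∫ z', f z' ∂π) u) s
          * tauHatGrad W (toLp 2 fun u : Fin (W + 1) => autocov κ π (fun z => f z - ∫ z', f z' ∂π) u) t
          * chainLagACov κ π (fun z => f z - ∫ z', f z' ∂π) W s t) := by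
  have hgrad := fun i : Fin (W + 1) =>
    chain_scorer_tauHatGrad_tendstoInMeasure_of_nHit κ W hπ hε hmin hf hC hσ μ₀ i
  have hcross := fun s t : Fin (W + 1) =>
    chain_empGammaCross_tendstoInMeasure_of_nHit κ W hπ hε hmin hm hf hC hK hK3 μ₀ s t
  exact tendstoInMeasure_finset_sum_lim _ fun s _ => tendstoInMeasure_finset_sum_lim _ fun t _ =>
    tendstoInMeasure_mul_lim (tendstoInMeasure_mul_lim (hgrad s) (hgrad t)) (hcross s t)

end Chain

end Summit.Ventures.LatticeQCDFlow.Scoring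

end
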